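import Summits.FinalStateConjecture.FinalStateConjecture.Theorems.PhaseMixingCaptureCaptureSufficesTameNoC0GlueChart
import Summits.FinalStateConjecture.FinalStateConjecture.Theorems.PhaseMixingCaptureCaptureSufficesTameNoC0FlatBasics
import Literature.Analysis.Calculus.MonotoneSmoothInverse
import HarnessLib

/-!
# `CaptureSufficesTame` (stmt-FinalStateConjecture-17270), line `only-the-third-law-is-generic`: glue stub
# `stub_noC0_glue` (oriented form), helper file 2 — curves through the chart

Curve-level tools for the glue between the flat causal future inside the chart image and the Kerr chunk
(namespace `NoC0Glue`), on top of the chart toolkit (`…NoC0GlueChart`):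

* `pullback_causalPath` — a path of `Φ '' Ω'` with future causal velocities of Minkowski space pulls back under a
  left inverse `G` of `Φ` to a differentiable path of `Ω'` with `Φ^*η`-causal future velocities, along which
  `‖Φ^*η − g_{M,a}‖ ≤ 1/4` (the shape consumed by the kinematic brick K3, `kerr_time_strictMonoOn_and_norm_sub_le`);
* `exists_extension` — continuation of a path beyond its parameter interval by the tangent lines at the endpoints
  (so that two-sided derivatives at the endpoints survive reparametrisation);
* `reparam` — reparametrisation of a path with `(c')⁰ > 0` on an open interval by the time coordinate `t* = x⁰`:
  inverse function rule in one variable for a merely differentiable strictly increasing function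
  (`HasDerivAt.of_local_left_inverse` with the continuity of monotone inverses), unit time speed `v / v⁰`;
* `mem_image_of_tendsto`, `ray_sup` — limit points through the chart, and the maximal forward extension of a ray
  inside a bounded open set;
* `stub_noC0_glueCurves` — the reparametrisation lemma as a closed statement (registered helper sub-goal).

References: B. O'Neill, *Semi-Riemannian geometry*, 1983, Ch. 5, p. 147 (time functions along causal curves);
M. Spivak, *Calculus*, Ch. 12, Thm. 5 (inverse of an increasing differentiable function) — folklore.
-/

-- the doubled `FinalStateConjecture.FinalStateConjecture` path component trips dupNamespace (as in the skeleton)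
set_option linter.dupNamespace false
set_option maxSynthPendingDepth 3

noncomputable section

open Set Filter Function Metric
open scoped Topology ContDiff

namespace Summit.FinalStateConjecture.FinalStateConjecture.Theorems.PhaseMixingCaptureCaptureSufficesTame

open Literature.Geometry.Lorentzian Literature.Analysis.Calculus

namespace NoC0Glue

/-! ## Pull-back of flat causal paths -/

section Pull

variable {M a ε : ℝ} {Ω Ω' : Set E4} {Φ G : E4 → E4}

/-- **Pull-back of a flat causal path.** Let `Φ` be an oriented `ε`-isometry (`ε ≤ 1/80`) of `Ω` into Minkowski
space with left inverse `G` on `Ω ⊇ Ω'`. A path `γ` of `Φ '' Ω'` with future causal velocities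
(`η(w, w) ≤ 0 < w⁰`) on a parameter set `s` pulls back to the path `G ∘ γ` of `Ω'`, differentiable on `s` with
`Φ^*η`-causal future velocities `(DΦ)⁻¹ w`, along which `‖Φ^*η − g_{M,a}‖ ≤ 1/4` (the shape consumed by the
kinematic brick K3). [folklore] -/
theorem pullback_causalPath (hM : 0 ≤ M) (hΩ : IsOpen Ω) (hΩext : Ω ⊆ (Kerr.exterior M a : Set E4))
    (hΦ : ContDiffOn ℝ ∞ Φ Ω) (hε : ε ≤ 1 / 80)
    (hclose : ∀ y ∈ Ω, ‖MetricCoord.pullMetric (fun _ ↦ Minkowski.bilin) Φ y - Kerr.bilin M a y‖ ≤ ε)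
    (hO : ∀ y ∈ Ω, ∀ v : E4, MetricCoord.pullMetric (fun _ ↦ Minkowski.bilin) Φ y v v ≤ 0 → 0 < v 0 →
      0 < (fderiv ℝ Φ y v) 0)
    (hG : ∀ y ∈ Ω, G (Φ y) = y) (hΩ'Ω : Ω' ⊆ Ω) {γ : ℝ → E4} {s : Set ℝ}
    (hγ : ∀ t ∈ s, γ t ∈ Φ '' Ω' ∧ ∃ w : E4, HasDerivAt γ w t ∧ Minkowski.bilin w w ≤ 0 ∧ 0 < w 0) :
    ∀ t ∈ s, (G ∘ γ) t ∈ Ω' ∧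
      ‖MetricCoord.pullMetric (fun _ ↦ Minkowski.bilin) Φ ((G ∘ γ) t) - Kerr.bilin M a ((G ∘ γ) t)‖ ≤ 1 / 4 ∧
      ∃ v : E4, HasDerivAt (G ∘ γ) v t ∧
        MetricCoord.pullMetric (fun _ ↦ Minkowski.bilin) Φ ((G ∘ γ) t) v v ≤ 0 ∧ 0 < v 0 := by
  intro t ht
  obtain ⟨⟨y, hyΩ', hy⟩, w, hw, hww, hw0⟩ := hγ t ht
  have hyΩ : y ∈ Ω := hΩ'Ω hyΩ'
  have hGt : (G ∘ γ) t = y := by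
    show G (γ t) = y
    rw [← hy, hG y hyΩ]
  rw [hGt]
  have hε5 : ε < 1 / 5 := by linarith
  have hB : ‖MetricCoord.pullMetric (fun _ ↦ Minkowski.bilin) Φ y - Kerr.bilin M a y‖ ≤ 1 / 4 :=
    (hclose y hyΩ).trans (by linarith)
  obtain ⟨e, he⟩ := exists_equiv_fderiv hM hΩext hε5 hclose hyΩ
  obtain ⟨hBe, he0⟩ := symm_causal_future hM hB (hO y hyΩ) he hww hw0
  refine ⟨hyΩ', hB, e.symm w, ?_, by rw [hBe]; exact hww, he0⟩
  exact hasDerivAt_inverse_comp hM hΩ hΩext hΦ hε5 hclose hG hyΩ he hw hy.symm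

end Pull

/-! ## Affine extension of a path beyond its parameter interval -/

/-- **Affine extension.** A path `c` differentiable at every point of `[a, b]` (`a < b`, two-sided derivatives
`v s`) agrees on `[a, b]` with a path `ĉ` differentiable on all of `ℝ`, whose derivative at `s` is
`v (max a (min s b))`: continue `c` by the tangent lines at the endpoints (gluing of paths with matching values
and derivatives). [folklore] -/
theorem exists_extension {c : ℝ → E4} {a b : ℝ} (hab : a < b) {v : ℝ → E4}
    (hc : ∀ s ∈ Icc a b, HasDerivAt c (v s) s) :
    ∃ ĉ : ℝ → E4, (∀ s ∈ Icc a b, ĉ s = c s) ∧ ∀ s, HasDerivAt ĉ (v (max a (min s b))) s := by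
  -- inner glue at `a`
  set g : ℝ → E4 := fun s ↦ if s ≤ a then c a + (s - a) • v a else c s with hg
  have haff : ∀ (p : ℝ) (s : ℝ), HasDerivAt (fun s ↦ c p + (s - p) • v p) (v p) s := by
    intro p s
    have h := (((hasDerivAt_id' s).sub_const p).smul_const (v p)).const_add (c p)
    simpa using h
  have hg_deriv : ∀ s ≤ b, HasDerivAt g (v (max a s)) s := by
    intro s hsb
    rcases lt_trichotomy s a with hlt | rfl | hgt
    · rw [max_eq_left hlt.le]
      exact (haff a s).congr_of_eventuallyEq (NoC0Flat.glue_eventuallyEq_left hlt)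
    · rw [max_self]
      exact NoC0Flat.hasDerivAt_glue (haff s s) (hc s ⟨le_rfl, hab.le⟩) (by simp)
    · rw [max_eq_right hgt.le]
      exact (hc s ⟨hgt.le, hsb⟩).congr_of_eventuallyEq (NoC0Flat.glue_eventuallyEq_right hgt)
  have hg_eq : ∀ s ∈ Icc a b, g s = c s := by
    intro s hs
    rcases hs.1.eq_or_lt with rfl | hlt
    · simp [hg]
    · simp [hg, not_le.2 hlt]
  -- outer glue at `b`
  refine ⟨fun s ↦ if s ≤ b then g s else c b + (s - b) • v b, fun s hs ↦ ?_, fun s ↦ ?_⟩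
  · simp only [hs.2, if_true]
    exact hg_eq s hs
  · rcases lt_trichotomy s b with hlt | rfl | hgt
    · rw [min_eq_left hlt.le]
      exact (hg_deriv s hlt.le).congr_of_eventuallyEq (NoC0Flat.glue_eventuallyEq_left hlt)
    · rw [min_self, max_eq_right hab.le]
      have h1 := hg_deriv s le_rfl
      rw [max_eq_right hab.le] at h1
      exact NoC0Flat.hasDerivAt_glue h1 (haff s s) (by rw [hg_eq s ⟨hab.le, le_rfl⟩]; simp)
    · rw [min_eq_right hgt.le, max_eq_right hab.le]
      exact (haff b s).congr_of_eventuallyEq (NoC0Flat.glue_eventuallyEq_right hgt)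

/-! ## Reparametrisation by the time coordinate -/

/-- **Reparametrisation by `t* = x⁰`.** Let `c` be a path with `c'(s) = v`, `v⁰ > 0` at every point of an open
interval `I`. Then `f(s) = (c s)⁰` is strictly increasing on `I`, and its inverse `φ` (`φ (f s) = s` on `I`,
`f (φ t) = t` and `φ t ∈ I` on `f '' I`, `φ` monotone there) is differentiable at every `t ∈ f '' I` with
`(c ∘ φ)'(t) = v / v⁰`, `v = c'(φ t)`: the reparametrised path has unit time speed (inverse function rule in
one variable, `HasDerivAt.of_local_left_inverse`, with continuity of the monotone inverse). [folklore] -/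
theorem reparam {I : Set ℝ} (hIo : IsOpen I) (hIc : I.OrdConnected) {c : ℝ → E4}
    (hc : ∀ s ∈ I, ∃ v : E4, HasDerivAt c v s ∧ 0 < v 0) :
    StrictMonoOn (fun s ↦ c s 0) I ∧
    ∃ φ : ℝ → ℝ, (∀ s ∈ I, φ (c s 0) = s) ∧ MonotoneOn φ ((fun s ↦ c s 0) '' I) ∧
      ∀ t ∈ (fun s ↦ c s 0) '' I, φ t ∈ I ∧ c (φ t) 0 = t ∧
        ∃ v : E4, HasDerivAt c v (φ t) ∧ HasDerivAt (c ∘ φ) ((v 0)⁻¹ • v) t := by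
  set f : ℝ → ℝ := fun s ↦ c s 0 with hf
  choose! V hV hV0 using hc
  have hfd : ∀ s ∈ I, HasDerivAt f (V s 0) s := fun s hs ↦ hasDerivAt_timeCoord (hV s hs)
  have hcont : ContinuousOn f I := fun s hs ↦ (hfd s hs).continuousAt.continuousWithinAt
  have hpos : ∀ s ∈ I, 0 < deriv f s := fun s hs ↦ by rw [(hfd s hs).deriv]; exact hV0 s hs
  have hmono : StrictMonoOn f I := strictMonoOn_of_deriv_pos' hIc hcont hpos
  have hopen : IsOpen (f '' I) := isOpen_image_of_strictMonoOn hIo hIc hcont hmono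
  set φ := invFunOn f I with hφ
  have hφf : ∀ s ∈ I, φ (f s) = s := fun s hs ↦ invFunOn_apply_of_injOn hmono.injOn hs
  have hfφ : ∀ t ∈ f '' I, φ t ∈ I ∧ f (φ t) = t := fun t ht ↦ invFunOn_image_mem_and_eq ht
  have hφmono : MonotoneOn φ (f '' I) := (strictMonoOn_invFunOn hmono).monotoneOn
  refine ⟨hmono, φ, hφf, hφmono, fun t ht ↦ ⟨(hfφ t ht).1, (hfφ t ht).2, V (φ t), hV _ (hfφ t ht).1, ?_⟩⟩
  have himage : φ '' (f '' I) = I := by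
    apply Subset.antisymm
    · rintro _ ⟨t', ht', rfl⟩
      exact (hfφ t' ht').1
    · intro s hs
      exact ⟨f s, ⟨s, hs, rfl⟩, hφf s hs⟩
  have hφcont : ContinuousAt φ t := by
    refine continuousAt_of_monotoneOn_of_image_mem_nhds hφmono (hopen.mem_nhds ht) ?_
    rw [himage]
    exact hIo.mem_nhds (hfφ t ht).1
  have hφd : HasDerivAt φ (V (φ t) 0)⁻¹ t := by
    refine (hfd (φ t) (hfφ t ht).1).of_local_left_inverse hφcont (hV0 _ (hfφ t ht).1).ne' ?_
    filter_upwards [hopen.mem_nhds ht] with t' ht' using (hfφ t' ht').2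
  exact (hV _ (hfφ t ht).1).scomp t hφd

/-! ## Two topological lemmas: limit points through the chart, maximal rays in a bounded open set -/

section Limit

variable {Ω Ω' : Set E4} {Φ G : E4 → E4}

/-- **Limit points of pulled-back points stay in the image.** If `Y n ∈ Φ '' Ω'` converge to `Yl` and the
pulled-back points `G (Y n)` stay in a compact subset `K ⊆ Ω'`, then `Yl ∈ Φ '' Ω'` (a subsequence of `G (Y n)`
converges to some `z ∈ K`, and `Φ z = Yl` by continuity of `Φ`). [folklore] -/
theorem mem_image_of_tendsto (hΩ : IsOpen Ω) (hΦ : ContDiffOn ℝ ∞ Φ Ω) (hΩ'Ω : Ω' ⊆ Ω)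
    (hG : ∀ y ∈ Ω, G (Φ y) = y) {K : Set E4} (hK : IsCompact K) (hKΩ' : K ⊆ Ω') {Y : ℕ → E4} {Yl : E4}
    (hYU : ∀ n, Y n ∈ Φ '' Ω') (hYK : ∀ n, G (Y n) ∈ K) (hlim : Tendsto Y atTop (𝓝 Yl)) :
    Yl ∈ Φ '' Ω' := by
  obtain ⟨z, hzK, ψ, hψ, hz⟩ := hK.tendsto_subseq hYK
  refine ⟨z, hKΩ' hzK, ?_⟩
  have h1 : Tendsto (fun n ↦ Φ (G (Y (ψ n)))) atTop (𝓝 (Φ z)) :=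
    (continuousAt_chart hΩ hΦ (hΩ'Ω (hKΩ' hzK))).tendsto.comp hz
  have h2 : (fun n ↦ Φ (G (Y (ψ n)))) = fun n ↦ Y (ψ n) := by
    funext n
    obtain ⟨y, hy, hyY⟩ := hYU (ψ n)
    rw [← hyY, hG y (hΩ'Ω hy)]
  rw [h2] at h1
  exact tendsto_nhds_unique h1 (hlim.comp hψ.tendsto_atTop)

/-- **Maximal forward extension of a ray inside a bounded open set.** If `P + λ d' ∈ U` for `λ ∈ [0, 1]`
(`d' ≠ 0`, `U` open and bounded), there is `Λ > 1` with `P + λ d' ∈ U` for `λ ∈ [0, Λ)` and `P + Λ d' ∉ U`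
(`Λ` = the supremum of the good parameters; openness pushes the segment beyond any good endpoint). [folklore] -/
theorem ray_sup {U : Set E4} (hU : IsOpen U) (hUb : Bornology.IsBounded U) {P d' : E4} (hd' : d' ≠ 0)
    (h1 : ∀ l ∈ Icc (0 : ℝ) 1, P + l • d' ∈ U) :
    ∃ Λ : ℝ, 1 < Λ ∧ (∀ l ∈ Ico 0 Λ, P + l • d' ∈ U) ∧ P + Λ • d' ∉ U := by
  set S : Set ℝ := {l | 0 ≤ l ∧ ∀ l' ∈ Icc 0 l, P + l' • d' ∈ U} with hS
  have h1S : (1 : ℝ) ∈ S := ⟨zero_le_one, h1⟩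
  have hne : S.Nonempty := ⟨1, h1S⟩
  obtain ⟨R₀, hR₀⟩ := hUb.subset_ball P
  have hdn : 0 < ‖d'‖ := norm_pos_iff.2 hd'
  have hbdd : BddAbove S := by
    refine ⟨R₀ / ‖d'‖, fun l hl ↦ ?_⟩
    have hmem := hR₀ (hl.2 l ⟨hl.1, le_rfl⟩)
    rw [mem_ball, dist_eq_norm, add_sub_cancel_left, norm_smul, Real.norm_eq_abs, abs_of_nonneg hl.1] at hmem
    rw [le_div_iff₀ hdn]
    exact hmem.le
  have hgood : ∀ l ∈ Ico 0 (sSup S), P + l • d' ∈ U := by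
    intro l hl
    obtain ⟨s, hs, hls⟩ := exists_lt_of_lt_csSup hne hl.2
    exact hs.2 l ⟨hl.1, hls.le⟩
  have hΛ1 : 1 ≤ sSup S := le_csSup hbdd h1S
  have hnot : P + sSup S • d' ∉ U := by
    intro hΛU
    obtain ⟨ρ, hρ, hball⟩ := Metric.isOpen_iff.1 hU _ hΛU
    obtain ⟨δ, hδ⟩ : ∃ δ, δ = ρ / (2 * ‖d'‖) := ⟨_, rfl⟩
    have hδ0 : 0 < δ := by rw [hδ]; positivity
    have hnear : ∀ l, |l - sSup S| ≤ δ → P + l • d' ∈ U := by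
      intro l hl
      apply hball
      rw [mem_ball, dist_eq_norm]
      have heq : P + l • d' - (P + sSup S • d') = (l - sSup S) • d' := by module
      rw [heq, norm_smul, Real.norm_eq_abs]
      calc |l - sSup S| * ‖d'‖ ≤ δ * ‖d'‖ := by gcongr
        _ = ρ / 2 := by rw [hδ]; field_simp
        _ < ρ := by linarith
    have hmem : sSup S + δ ∈ S := by
      refine ⟨by linarith, fun l' hl' ↦ ?_⟩
      rcases lt_or_ge l' (sSup S - δ) with h | h
      · exact hgood l' ⟨hl'.1, by linarith⟩
      · exact hnear l' (abs_le.2 ⟨by linarith, by linarith [hl'.2]⟩)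
    have := le_csSup hbdd hmem
    linarith
  refine ⟨sSup S, lt_of_le_of_ne hΛ1 ?_, hgood, hnot⟩
  intro h1eq
  apply hnot
  rw [← h1eq, one_smul]
  have := h1 1 ⟨zero_le_one, le_rfl⟩
  rwa [one_smul] at this

end Limit

end NoC0Glue

open NoC0Glue in
/-- **Reparametrisation by the time coordinate (registered helper sub-goal `stub_noC0_glueCurves` of the glue
stub).** A path `c : ℝ → E4` with `c'(s) = v`, `v⁰ > 0` at every point of an open interval `I` has strictly
increasing time coordinate `f(s) = (c s)⁰` on `I`, and the inverse `φ` of `f` (`φ ∘ f = id` on `I`, `f ∘ φ = id`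
and `φ ∈ I` on `f '' I`, `φ` monotone there) makes `c ∘ φ` differentiable at every `t ∈ f '' I` with velocity
`v / v⁰`, `v = c'(φ t)` (unit time speed). [folklore] -/
theorem stub_noC0_glueCurves :
    ∀ (I : Set ℝ) (c : ℝ → E4), IsOpen I → I.OrdConnected → (∀ s ∈ I, ∃ v : E4, HasDerivAt c v s ∧ 0 < v 0) →
      StrictMonoOn (fun s ↦ c s 0) I ∧
      ∃ φ : ℝ → ℝ, (∀ s ∈ I, φ (c s 0) = s) ∧ MonotoneOn φ ((fun s ↦ c s 0) '' I) ∧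
        ∀ t ∈ (fun s ↦ c s 0) '' I, φ t ∈ I ∧ c (φ t) 0 = t ∧
          ∃ v : E4, HasDerivAt c v (φ t) ∧ HasDerivAt (c ∘ φ) ((v 0)⁻¹ • v) t :=
  fun _ _ hIo hIc hc ↦ reparam hIo hIc hc

end Summit.FinalStateConjecture.FinalStateConjecture.Theorems.PhaseMixingCaptureCaptureSufficesTame

end
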